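import Summits.SmoothPoincare4.SmoothPoincare4.Theorems.SoloInformedPretzelSurgeryNine23G0
import Summits.SmoothPoincare4.SmoothPoincare4.Theorems.SoloInformedPretzelSurgeryNine23G10
import Summits.SmoothPoincare4.SmoothPoincare4.Theorems.SoloInformedPretzelSurgeryNine23Rx2
import Summits.SmoothPoincare4.SmoothPoincare4.Theorems.SoloInformedPretzelSurgeryNine23Rz
import Summits.SmoothPoincare4.SmoothPoincare4.Theorems.SoloInformedPretzelSurgeryNine23Nx
import Summits.SmoothPoincare4.SmoothPoincare4.Theorems.SoloInformedPretzelSurgeryNine23Nz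
import Summits.SmoothPoincare4.SmoothPoincare4.Theorems.SoloInformedPretzelSurgeryNine23Ry2
import Summits.SmoothPoincare4.SmoothPoincare4.Theorems.SoloInformedPretzelSurgeryNine23Ny

/-!
# `|π₁(S³₂₃(P(-2,3,9)))| = 2760`, unconditionally

The slope-23 surgery group `G23 = ⟨a₀,…,a₁₃ ∣ Wirtinger(P(-2,3,9)), μ²³λ⟩` (PD-code presentation of
`SoloInformedPretzelSurgeryQuotients`) has order exactly `2760`, `ρ23 : G23 →* ℤ/23 × SL(2,𝔽₅)` is an
isomorphism, and all nine identities of `NineIdentities23` hold — with no hypothesis.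

Eight of the nine identities (and seven arc coincidences) are kernel-certified van Kampen discs
(`…Nine23G0/G10/Rx2/Rz/Nx/Nz/Ry2(b)/Ny(b)`, `…Arcs23A/B`: the identity loops are made trivial modulo a free-abelian
oracle by inserting cyclic conjugates of the surgery relator and then filled in a finite piece of the universal
cover of the arc-coincidence quotient complex).  The ninth, `μ²³ = zy⁻¹z⁻¹x`, is bypassed exactly as for slope 17
(`SoloInformedPretzelSurgeryCard`): with `K = ψ(⟨2,3,5⟩) = ⟨x,y,z⟩` (order `≤ 120`, normalised by `μ`),
every arc generator lies in the coset `Kμ`, so the surgery relation `μ²³·λ'·μ⁻¹⁴ = 1` puts `μ²³` in `K`;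
then `|G23| ≤ 23·120`, `ρ23` is bijective, and `pow23` follows from injectivity (`nine23_of_injective`).
Solo programme `solo-SmoothPoincare4-informed`, s111–s112.
-/

namespace Summit.SmoothPoincare4.SmoothPoincare4.Theorems
namespace PretzelSurgery

open Literature.Algebra.Homology.RelationModule

/-- The relators of `⟨2,3,5⟩` are killed by `x, y, z ∈ G23` (kernel-certified `relX/relY/relZ`). -/
theorem lift_icoGen23' : ∀ r ∈ binaryTriangleRels 2 3 5, FreeGroup.lift icoGen23 r = 1 := by
  rintro r ⟨i, rfl⟩
  fin_cases i
  · simp only [powRelWord, xyzWord, triExp, map_mul, map_inv, map_pow, FreeGroup.lift_apply_of, icoGen23]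
    simp only [Fin.zero_eta, Matrix.cons_val_zero, Matrix.cons_val_one, Matrix.cons_val, mul_inv_eq_one]
    exact relX23_holds
  · simp only [powRelWord, xyzWord, triExp, map_mul, map_inv, map_pow, FreeGroup.lift_apply_of, icoGen23]
    simp only [Matrix.cons_val_zero, Fin.mk_one, Matrix.cons_val_one, Matrix.cons_val, mul_inv_eq_one]
    exact relY23_holds
  · simp only [powRelWord, xyzWord, triExp, map_mul, map_inv, map_pow, FreeGroup.lift_apply_of, icoGen23]
    simp only [Matrix.cons_val_zero, Matrix.cons_val_one, Matrix.cons_val, Fin.reduceFinMk, mul_inv_eq_one]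
    exact relZ23_holds

/-- `ψ : ⟨2,3,5⟩ →* G23`, unconditionally. -/
def psi23u : B235 →* G23 := PresentedGroup.toGroup lift_icoGen23'

/-- `ψ` on generators. -/
theorem psi23u_of (i : Fin 3) : psi23u (PresentedGroup.of i) = icoGen23 i := by unfold psi23u; exact PresentedGroup.toGroup.of _

/-- The surgery relation in the form `μ²³ · λ' · (μ¹⁴)⁻¹ = 1`, `λ' = a₀a₈a₆a₄a₂a₀a₁₃a₉a₁a₉a₇a₅a₃a₁₀`. -/
theorem surgery_pow23 : mu11 ^ 23 * (g23 0 * g23 8 * g23 6 * g23 4 * g23 2 * g23 0 * g23 13 * g23 9 * g23 1 *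
    g23 9 * g23 7 * g23 5 * g23 3 * g23 10) * (mu11 ^ 14)⁻¹ = 1 := by
  have h := t23_w14
  simp only [pow_succ, pow_zero, one_mul, mul_inv_rev, mu11, mul_assoc] at h ⊢
  exact h

/-- **Main theorem (unconditional).** `G23` is finite of order at most `2760`. -/
theorem finite_and_card_le23 : Finite G23 ∧ Nat.card G23 ≤ 2760 := by
  -- `K = ψ(⟨2,3,5⟩) ∋ x, y, z`, finite of order `≤ 120`
  set K : Subgroup G23 := psi23u.range with hKdef
  have hx : xJ ∈ K := ⟨PresentedGroup.of 0, psi23u_of 0⟩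
  have hy : yJ ∈ K := ⟨PresentedGroup.of 1, psi23u_of 1⟩
  have hz : zJ ∈ K := ⟨PresentedGroup.of 2, psi23u_of 2⟩
  haveI : Finite B235 := BinaryIcosahedralOrder.finite
  haveI hKfin : Finite K := Finite.of_surjective _ psi23u.rangeRestrict_surjective
  have hKcard : Nat.card K ≤ 120 :=
    (Nat.card_le_card_of_surjective _ psi23u.rangeRestrict_surjective).trans BinaryIcosahedralOrder.card_le
  -- `μ K μ⁻¹ ≤ K`
  have hconj : ∀ k ∈ K, mu11 * k * mu11⁻¹ ∈ K := by
    have hgen : ∀ i : Fin 3, (PresentedGroup.of i : B235) ∈ K.comap ((MulAut.conj mu11).toMonoidHom.comp psi23u) := by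
      intro i
      simp only [Subgroup.mem_comap, MonoidHom.coe_comp, MulEquiv.coe_toMonoidHom, Function.comp_apply,
        MulAut.conj_apply, psi23u_of, icoGen23]
      fin_cases i
      · simp only [Fin.zero_eta, Matrix.cons_val_zero, conjX23_holds]
        exact K.mul_mem (K.mul_mem (K.mul_mem (K.mul_mem (K.mul_mem (K.mul_mem hy hx) (K.inv_mem hy)) (K.inv_mem hz)) hx) hz) hy
      · simp only [Fin.mk_one, Matrix.cons_val_one, Matrix.cons_val_zero, conjY23_holds]
        exact K.mul_mem (K.mul_mem (K.mul_mem (K.mul_mem hz (K.inv_mem hy)) (K.inv_mem hz)) hx) (K.inv_mem hy)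
      · simp only [Fin.reduceFinMk, Matrix.cons_val, conjZ23_holds]
        exact K.mul_mem (K.mul_mem hz hz) (K.inv_mem hy)
    rintro k ⟨b, rfl⟩
    have hb := PresentedGroup.generated_by _ _ hgen b
    simpa only [Subgroup.mem_comap, MonoidHom.coe_comp, MulEquiv.coe_toMonoidHom, Function.comp_apply,
      MulAut.conj_apply] using hb
  have hconj_pow : ∀ n : ℕ, ∀ k ∈ K, mu11 ^ n * k * (mu11 ^ n)⁻¹ ∈ K := by
    intro n
    induction n with
    | zero => intro k hk; simpa using hk
    | succ n ih =>
      intro k hk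
      have e : mu11 ^ (n + 1) * k * (mu11 ^ (n + 1))⁻¹ = mu11 * (mu11 ^ n * k * (mu11 ^ n)⁻¹) * mu11⁻¹ := by
        rw [pow_succ']; group
      rw [e]; exact hconj _ (ih k hk)
  -- every arc generator lies in the coset `K μ`
  have q11 : g23 11 * mu11⁻¹ ∈ K := by rw [mu11, mul_inv_cancel]; exact K.one_mem
  have q8 : g23 8 * mu11⁻¹ ∈ K := by rw [g23_8_eq_11]; exact q11
  have q4 : g23 4 * mu11⁻¹ ∈ K := by rw [g23_4_eq_8]; exact q8
  have q0 : g23 0 * mu11⁻¹ ∈ K := by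
    rw [arc0_23_holds, mul_inv_cancel_right]; exact K.mul_mem hx (K.inv_mem hy)
  have q10 : g23 10 * mu11⁻¹ ∈ K := by
    rw [arc10_23_holds, mul_inv_cancel_right]
    exact K.mul_mem (K.mul_mem (K.mul_mem (K.inv_mem hz) hx) hz) (K.inv_mem hy)
  have q9 : g23 9 * mu11⁻¹ ∈ K := by rw [g23_9_eq_10]; exact q10
  have q5 : g23 5 * mu11⁻¹ ∈ K := by rw [g23_5_eq_9]; exact q9
  have q1 : g23 1 * mu11⁻¹ ∈ K := by
    have e : g23 1 * mu11⁻¹ = zJ * (g23 0 * mu11⁻¹) := by rw [zJ]; group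
    rw [e]; exact K.mul_mem hz q0
  have q2 : g23 2 * mu11⁻¹ ∈ K := by
    have e : g23 2 * mu11⁻¹ = xJ * (g23 4 * mu11⁻¹) := by rw [xJ]; group
    rw [e]; exact K.mul_mem hx q4
  have q6 : g23 6 * mu11⁻¹ ∈ K := by rw [← g23_2_eq_6]; exact q2
  have q13 : g23 13 * mu11⁻¹ ∈ K := by rw [← g23_6_eq_13]; exact q6
  have q3 : g23 3 * mu11⁻¹ ∈ K := by
    -- `a₃ = a₂ a₁₀ a₂⁻¹` (Wirtinger `t23_w9`)
    have e1 : g23 3 = g23 2 * g23 10 * (g23 2)⁻¹ := by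
      have h := t23_w9
      rw [mul_inv_eq_one] at h
      rw [← h]; group
    have e : g23 3 * mu11⁻¹ = (g23 2 * mu11⁻¹) * (mu11 * ((g23 10 * mu11⁻¹) * (g23 2 * mu11⁻¹)⁻¹) * mu11⁻¹) := by
      rw [e1]; group
    rw [e]; exact K.mul_mem q2 (hconj _ (K.mul_mem q10 (K.inv_mem q2)))
  have q7 : g23 7 * mu11⁻¹ ∈ K := by rw [← g23_3_eq_7]; exact q3
  have q12 : g23 12 * mu11⁻¹ ∈ K := by
    -- `a₁₂ = a₉ a₀ a₉⁻¹` (Wirtinger `t23_w1`)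
    have e1 : g23 12 = g23 9 * g23 0 * (g23 9)⁻¹ := by
      have h := t23_w1
      rw [mul_inv_eq_one] at h
      rw [← h]; group
    have e : g23 12 * mu11⁻¹ = (g23 9 * mu11⁻¹) * (mu11 * ((g23 0 * mu11⁻¹) * (g23 9 * mu11⁻¹)⁻¹) * mu11⁻¹) := by
      rw [e1]; group
    rw [e]; exact K.mul_mem q9 (hconj _ (K.mul_mem q0 (K.inv_mem q9)))
  -- hence the longitude word lies in `K μ¹⁴`
  have stepQ : ∀ (m : ℕ) (u a : G23), u * (mu11 ^ m)⁻¹ ∈ K → a * mu11⁻¹ ∈ K →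
      u * a * (mu11 ^ (m + 1))⁻¹ ∈ K := by
    intro m u a hu ha
    have e : u * a * (mu11 ^ (m + 1))⁻¹ = (u * (mu11 ^ m)⁻¹) * (mu11 ^ m * (a * mu11⁻¹) * (mu11 ^ m)⁻¹) := by
      rw [pow_succ]; group
    rw [e]; exact K.mul_mem hu (hconj_pow m _ ha)
  have hL : g23 0 * g23 8 * g23 6 * g23 4 * g23 2 * g23 0 * g23 13 * g23 9 * g23 1 * g23 9 * g23 7 * g23 5 * g23 3 *
      g23 10 * (mu11 ^ 14)⁻¹ ∈ K := by
    have s1 : g23 0 * (mu11 ^ 1)⁻¹ ∈ K := by rw [pow_one]; exact q0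
    exact stepQ 13 _ _ (stepQ 12 _ _ (stepQ 11 _ _ (stepQ 10 _ _ (stepQ 9 _ _ (stepQ 8 _ _ (stepQ 7 _ _
      (stepQ 6 _ _ (stepQ 5 _ _ (stepQ 4 _ _ (stepQ 3 _ _ (stepQ 2 _ _ (stepQ 1 _ _ s1 q8) q6) q4) q2) q0) q13)
      q9) q1) q9) q7) q5) q3) q10
  -- and the surgery relation gives `μ²³ ∈ K`
  have h17 : mu11 ^ 23 ∈ K := by
    have e : mu11 ^ 23 = (g23 0 * g23 8 * g23 6 * g23 4 * g23 2 * g23 0 * g23 13 * g23 9 * g23 1 * g23 9 * g23 7 *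
        g23 5 * g23 3 * g23 10 * (mu11 ^ 14)⁻¹)⁻¹ := by
      rw [eq_inv_iff_mul_eq_one, ← surgery_pow23]; group
    rw [e]; exact K.inv_mem hL
  -- `μ⁻¹ K μ ≤ K`, using `μ⁻¹ = μ²² (μ²³)⁻¹`
  have hconj' : ∀ k ∈ K, mu11⁻¹ * k * mu11 ∈ K := by
    intro k hk
    have e : mu11⁻¹ * k * mu11 = mu11 ^ 22 * ((mu11 ^ 23)⁻¹ * k * mu11 ^ 23) * (mu11 ^ 22)⁻¹ := by group
    rw [e]; exact hconj_pow 22 _ (K.mul_mem (K.mul_mem (K.inv_mem h17) hk) h17)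
  have hconj'_pow : ∀ n : ℕ, ∀ k ∈ K, (mu11 ^ n)⁻¹ * k * mu11 ^ n ∈ K := by
    intro n
    induction n with
    | zero => intro k hk; simpa using hk
    | succ n ih =>
      intro k hk
      have e : (mu11 ^ (n + 1))⁻¹ * k * mu11 ^ (n + 1) = mu11⁻¹ * ((mu11 ^ n)⁻¹ * k * mu11 ^ n) * mu11 := by
        rw [pow_succ]; group
      rw [e]; exact hconj' _ (ih k hk)
  -- the normal form `μⁿ k`
  let P : G23 → Prop := fun g => ∃ n : ℕ, ∃ k ∈ K, g = mu11 ^ n * k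
  have P1 : P 1 := ⟨0, 1, K.one_mem, by simp⟩
  have Pmu11 : ∀ g, P g → P (mu11 * g) := by
    rintro g ⟨n, k, hk, rfl⟩; exact ⟨n + 1, k, hk, by rw [pow_succ']; group⟩
  have Pmu11' : ∀ g, P g → P (mu11⁻¹ * g) := by
    rintro g ⟨n, k, hk, rfl⟩
    refine ⟨n + 22, (mu11 ^ 23)⁻¹ * k, K.mul_mem (K.inv_mem h17) hk, ?_⟩
    rw [pow_add]; group
  have PK : ∀ k' ∈ K, ∀ g, P g → P (k' * g) := by
    rintro k' hk' g ⟨n, k, hk, rfl⟩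
    refine ⟨n, (mu11 ^ n)⁻¹ * k' * mu11 ^ n * k, K.mul_mem (hconj'_pow n k' hk') hk, ?_⟩
    group
  have PKinv : ∀ k' ∈ K, ∀ g, P g → P (k'⁻¹ * g) := fun k' hk' g hg => PK _ (K.inv_mem hk') g hg
  have hw0 : xJ * yJ⁻¹ ∈ K := K.mul_mem hx (K.inv_mem hy)
  have hw10 : zJ⁻¹ * xJ * zJ * yJ⁻¹ ∈ K := K.mul_mem (K.mul_mem (K.mul_mem (K.inv_mem hz) hx) hz) (K.inv_mem hy)
  have Pall : ∀ g ∈ Subgroup.closure ({g23 0, g23 10, g23 11} : Set G23), P g := by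
    intro g hg
    refine Subgroup.closure_induction_left (p := fun g _ => P g) P1 ?_ ?_ hg
    · rintro a ha g - hPg
      simp only [Set.mem_insert_iff, Set.mem_singleton_iff] at ha
      rcases ha with rfl | rfl | rfl
      · rw [arc0_23_holds, mul_assoc]; exact PK _ hw0 _ (Pmu11 _ hPg)
      · rw [arc10_23_holds, mul_assoc]; exact PK _ hw10 _ (Pmu11 _ hPg)
      · exact Pmu11 _ hPg
    · rintro a ha g - hPg
      simp only [Set.mem_insert_iff, Set.mem_singleton_iff] at ha
      rcases ha with rfl | rfl | rfl
      · rw [arc0_23_holds, mul_inv_rev, mul_assoc]; exact Pmu11' _ (PKinv _ hw0 _ hPg)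
      · rw [arc10_23_holds, mul_inv_rev, mul_assoc]; exact Pmu11' _ (PKinv _ hw10 _ hPg)
      · exact Pmu11' _ hPg
  have htop : ∀ g : G23, g ∈ Subgroup.closure ({g23 0, g23 10, g23 11} : Set G23) := by
    intro g
    obtain ⟨b, rfl⟩ := σ23_surjective g
    have hgen : ∀ i : Fin 3, (PresentedGroup.of i : G23c) ∈
        (Subgroup.closure ({g23 0, g23 10, g23 11} : Set G23)).comap σ23 := by
      intro i
      rw [Subgroup.mem_comap, show σ23 (PresentedGroup.of i) = kept23 i from PresentedGroup.toGroup.of _]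
      apply Subgroup.subset_closure
      fin_cases i <;> simp [kept23]
    exact PresentedGroup.generated_by _ _ hgen b
  let f : Fin 23 × K → G23 := fun p => mu11 ^ (p.1 : ℕ) * p.2
  have hf : Function.Surjective f := by
    intro g
    obtain ⟨n, k, hk, rfl⟩ := Pall g (htop g)
    refine ⟨(⟨n % 23, Nat.mod_lt _ (by norm_num)⟩, ⟨(mu11 ^ 23) ^ (n / 23) * k, K.mul_mem (K.pow_mem h17 _) hk⟩), ?_⟩
    show mu11 ^ (n % 23) * ((mu11 ^ 23) ^ (n / 23) * k) = mu11 ^ n * k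
    rw [← mul_assoc, ← pow_mul, ← pow_add, Nat.mod_add_div]
  haveI : Finite G23 := Finite.of_surjective f hf
  refine ⟨inferInstance, ?_⟩
  calc Nat.card G23 ≤ Nat.card (Fin 23 × K) := Nat.card_le_card_of_surjective f hf
    _ = 23 * Nat.card K := by rw [Nat.card_prod, Nat.card_eq_fintype_card, Fintype.card_fin]
    _ ≤ 23 * 120 := Nat.mul_le_mul_left _ hKcard

/-- **UNCONDITIONAL: `|π₁(S³₂₃(P(-2,3,9)))| = |G23| = 2760` and `ρ23` is an isomorphism.** -/
theorem card_G23_and_bijective : Nat.card G23 = 2760 ∧ Function.Bijective ρ23 := by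
  obtain ⟨hfin, hle⟩ := finite_and_card_le23
  haveI := hfin
  exact ⟨le_antisymm hle le_card_G23, bijective_ρ23_of_card_le hle⟩

/-- `Nat.card G23 = 2760`. -/
theorem card_G23 : Nat.card G23 = 2760 := card_G23_and_bijective.1

/-- `ρ23 : G23 →* ℤ/23 × SL(2,𝔽₅)` is bijective. -/
theorem bijective_ρ23 : Function.Bijective ρ23 := card_G23_and_bijective.2

/-- `G23` is finite. -/
theorem finite_G23 : Finite G23 := finite_and_card_le23.1

/-- The isomorphism `G23 ≃* ℤ/23 × SL(2,𝔽₅)`. -/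
noncomputable def mulEquivK23 : G23 ≃* K23 := MulEquiv.ofBijective ρ23 bijective_ρ23

/-- All nine identities hold in `G23` (eight by disc certificates, `pow23` via injectivity of `ρ23`). -/
theorem nineIdentities23 : NineIdentities23 := nine23_of_injective bijective_ρ23.1

/-- `μ²³ = zy⁻¹z⁻¹x` in `G23`. -/
theorem pow23_holds : mu11 ^ 23 = zJ * yJ⁻¹ * zJ⁻¹ * xJ := nineIdentities23.pow23

end PretzelSurgery
end Summit.SmoothPoincare4.SmoothPoincare4.Theorems
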